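import Summits.ResolutionOfSingularities.ResolutionOfSingularities.Theorems.FrobeniusLadderFInjectiveMacaulayficationAffineBlowupPolynomial
import Summits.ResolutionOfSingularities.ResolutionOfSingularities.Theorems.FrobeniusLadderFInjectiveMacaulayficationStrongPlusStepOfAffineBlowup
import HarnessLib

/-!
# THE CYLINDER PRODUCER (R11.11 S5): a point model `Bl_I X₀` good at every stalk ⟹ a STRONG⁺ confined iso-step for `X₀ × 𝔸¹`
# along `V(I) × 𝔸¹` (crux `FInjectiveMacaulayfication` stmt-ResolutionOfSingularities-15315, chain w45a, hole #3;
# owner res-D-pv-017 AS res-L1-w45a-stub-5)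

Support file for crux stmt-ResolutionOfSingularities-15315 (`FrobeniusLadder.FInjectiveMacaulayfication`), chain w45a.
[OURS · L1 W4.5a] — NOT a statement of any manuscript; AI-written, weaker than expert review.

`strongPlusStep_cylinder_of_pointModel`: for ANY affine `X₀ = Spec R` (`R` a Noetherian domain of characteristic `p`) with a
centre `I ≠ 0` whose affine blow-up is a domain satisfying the crux's clause at EVERY stalk (the output format of every engine:
CN `CNConeFiModelRelBlowup.affineBlowup_fiClause_of_cnData`, E6‴ `affineBlowup_fiClause_of_cover`, …), the cylinder
`X₀ × 𝔸¹ = Spec R[t]` with centre `I·R[t]` has the STRONG⁺ ∃-clause of hole #3 (`stub_confinedIsoStepStrongPlus`) at every point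
`η` with `V(η) = V(I·R[t])` (e.g. the generic point of `V(I) × 𝔸¹` when `√I` is prime; `StrongPlusStepOfAffineBlowup.supp_iff_of_radical_eq`).
Proof: `AffineBlowupPolynomial.affineBlowup_fiClause_polynomial` (S4: the clause ascends to `Bl_{I R[t]}`, EVERY residue field —
no separability, cf. the analysis in `PolynomialLocalizationClause`) + `StrongPlusStepOfAffineBlowup.strongPlusStep_of_affineBlowup`
(p499685). Iterating S4 gives `X₀ × 𝔸^m`. No definitions, no named facts. [folklore]
-/

-- single-problem summit: the doubled namespace component is forced
set_option linter.dupNamespace false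

noncomputable section

open Polynomial AlgebraicGeometry CategoryTheory Literature.AlgebraicGeometry.Resolution

namespace Summit.ResolutionOfSingularities.ResolutionOfSingularities.Theorems.FInjectiveMacaulayfication.CylinderOfPointModel

open Summit.ResolutionOfSingularities.ResolutionOfSingularities.Theorems.FInjectiveMacaulayfication

/-- **THE CYLINDER PRODUCER.** `R` Noetherian domain of characteristic `p`, `I ≠ 0` with `Bl_I(R)` a domain satisfying the clause
at every stalk, `η` a point of `Spec R[t]` with `V(η) = V(I·R[t])` ⟹ the STRONG⁺ confined iso-step ∃-clause for `Spec R[t]` at `η`,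
realised by `Bl_{I R[t]} = Bl_I × 𝔸¹`. Every field, every residue field. [folklore] -/
theorem strongPlusStep_cylinder_of_pointModel (p : ℕ) [Fact p.Prime] (R : Type) [CommRing R] [IsDomain R] [IsNoetherianRing R]
    [CharP R p] (I : Ideal R) (hI0 : I ≠ ⊥)
    (hBl : ∀ y : ↥(affineBlowup I), IsDomain ((affineBlowup I).presheaf.stalk y) ∧
      ∀ d : ℕ, ringKrullDim ((affineBlowup I).presheaf.stalk y) = d →
        ∀ s : Fin d → (affineBlowup I).presheaf.stalk y, (Ideal.span (Set.range s)).radical.IsMaximal →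
          RingTheory.Sequence.IsWeaklyRegular ((affineBlowup I).presheaf.stalk y) (List.ofFn s) ∧
          ∀ z : (affineBlowup I).presheaf.stalk y, (∃ e : ℕ, z ^ p ^ e ∈
              Ideal.span ((fun w : (affineBlowup I).presheaf.stalk y => w ^ p ^ e) ''
                (Ideal.span (Set.range s) : Set ((affineBlowup I).presheaf.stalk y)))) →
            z ∈ Ideal.span (Set.range s))
    (η : ↥(Spec (.of R[X])))
    (hsupp : ∀ (P : Ideal R[X]) [P.IsPrime], I.map (C : R →+* R[X]) ≤ P ↔ η.asIdeal ≤ P) :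
    ∃ (X₂ : Scheme.{0}) (π : X₂ ⟶ Spec (.of R[X])), IsProper π ∧
      Literature.AlgebraicGeometry.Resolution.IsBirational π ∧
      IsIntegral X₂ ∧ (∀ x : X₂, (∀ d : ℕ, ringKrullDim (X₂.presheaf.stalk x) = d → ∀ s : Fin d → X₂.presheaf.stalk x, (Ideal.span (Set.range s)).radical.IsMaximal → RingTheory.Sequence.IsWeaklyRegular (X₂.presheaf.stalk x) (List.ofFn s))) ∧
      IsIso (π ∣_ ⟨(closure ({η} : Set ↥(Spec (.of R[X]))))ᶜ, isClosed_closure.isOpen_compl⟩) ∧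
      ∀ x : X₂, π.base x ∈ closure ({η} : Set ↥(Spec (.of R[X]))) → ¬ IsClosed ({x} : Set X₂) → (IsDomain (X₂.presheaf.stalk x) ∧ ∀ d : ℕ, ringKrullDim (X₂.presheaf.stalk x) = d → ∀ s : Fin d → X₂.presheaf.stalk x, (Ideal.span (Set.range s)).radical.IsMaximal → RingTheory.Sequence.IsWeaklyRegular (X₂.presheaf.stalk x) (List.ofFn s) ∧ ∀ t : X₂.presheaf.stalk x, (∃ e : ℕ, t ^ p ^ e ∈ Ideal.span ((fun z : X₂.presheaf.stalk x => z ^ p ^ e) '' (Ideal.span (Set.range s) : Set (X₂.presheaf.stalk x)))) → t ∈ Ideal.span (Set.range s)) := by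
  have hI' : I.map (C : R →+* R[X]) ≠ ⊥ := fun h =>
    hI0 ((Ideal.map_eq_bot_iff_of_injective (Polynomial.C_injective)).mp h)
  exact StrongPlusStepOfAffineBlowup.strongPlusStep_of_affineBlowup p R[X] (I.map (C : R →+* R[X])) hI' η hsupp
    (AffineBlowupPolynomial.affineBlowup_fiClause_polynomial p R I hBl)

/-- The same with the generic point of `V(I·R[t])` supplied from `√(I·R[t]) = η`. [folklore] -/
theorem strongPlusStep_cylinder_of_pointModel_of_radical_eq (p : ℕ) [Fact p.Prime] (R : Type) [CommRing R] [IsDomain R]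
    [IsNoetherianRing R] [CharP R p] (I : Ideal R) (hI0 : I ≠ ⊥)
    (hBl : ∀ y : ↥(affineBlowup I), IsDomain ((affineBlowup I).presheaf.stalk y) ∧
      ∀ d : ℕ, ringKrullDim ((affineBlowup I).presheaf.stalk y) = d →
        ∀ s : Fin d → (affineBlowup I).presheaf.stalk y, (Ideal.span (Set.range s)).radical.IsMaximal →
          RingTheory.Sequence.IsWeaklyRegular ((affineBlowup I).presheaf.stalk y) (List.ofFn s) ∧
          ∀ z : (affineBlowup I).presheaf.stalk y, (∃ e : ℕ, z ^ p ^ e ∈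
              Ideal.span ((fun w : (affineBlowup I).presheaf.stalk y => w ^ p ^ e) ''
                (Ideal.span (Set.range s) : Set ((affineBlowup I).presheaf.stalk y)))) →
            z ∈ Ideal.span (Set.range s))
    (η : ↥(Spec (.of R[X]))) (hrad : (I.map (C : R →+* R[X])).radical = η.asIdeal) :
    ∃ (X₂ : Scheme.{0}) (π : X₂ ⟶ Spec (.of R[X])), IsProper π ∧
      Literature.AlgebraicGeometry.Resolution.IsBirational π ∧
      IsIntegral X₂ ∧ (∀ x : X₂, (∀ d : ℕ, ringKrullDim (X₂.presheaf.stalk x) = d → ∀ s : Fin d → X₂.presheaf.stalk x, (Ideal.span (Set.range s)).radical.IsMaximal → RingTheory.Sequence.IsWeaklyRegular (X₂.presheaf.stalk x) (List.ofFn s))) ∧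
      IsIso (π ∣_ ⟨(closure ({η} : Set ↥(Spec (.of R[X]))))ᶜ, isClosed_closure.isOpen_compl⟩) ∧
      ∀ x : X₂, π.base x ∈ closure ({η} : Set ↥(Spec (.of R[X]))) → ¬ IsClosed ({x} : Set X₂) → (IsDomain (X₂.presheaf.stalk x) ∧ ∀ d : ℕ, ringKrullDim (X₂.presheaf.stalk x) = d → ∀ s : Fin d → X₂.presheaf.stalk x, (Ideal.span (Set.range s)).radical.IsMaximal → RingTheory.Sequence.IsWeaklyRegular (X₂.presheaf.stalk x) (List.ofFn s) ∧ ∀ t : X₂.presheaf.stalk x, (∃ e : ℕ, t ^ p ^ e ∈ Ideal.span ((fun z : X₂.presheaf.stalk x => z ^ p ^ e) '' (Ideal.span (Set.range s) : Set (X₂.presheaf.stalk x)))) → t ∈ Ideal.span (Set.range s))  :=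
  strongPlusStep_cylinder_of_pointModel p R I hI0 hBl η
    (fun P _ => StrongPlusStepOfAffineBlowup.supp_iff_of_radical_eq (I.map (C : R →+* R[X])) η hrad P)

end Summit.ResolutionOfSingularities.ResolutionOfSingularities.Theorems.FInjectiveMacaulayfication.CylinderOfPointModel

end
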